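/-
Origin: expansion seat `prover-pub-hodgecm-own-htheta-g2-0`, handover #H28 2026-08-21T13:47:42Z md5 f14cf400686c (131 l.; NEW additive MODEL leaf — `_ge` twin(s) D6 D7: Gen12PinsP2.gen12_R2C_of_GOG_ge, gen12_R2CE_ge; imports Binders.Gen12PinsROGT2 + #H27; author item6-p2 (prover-pub-hodgecm2-item6-p2-0) under own-htheta; nothing cited, NOT an E term; sha256 da603cde143c5bcfa88969aee727d337559a5a18919804c43b16697f77799753; CERT rc 0 + trio as in the header; NAMES for audit: HodgeCM.Model.Gen12PinsP2.gen12_R2C_of_GOG_ge HodgeCM.Model.Gen12PinsP2.gen12_R2CE_ge ) (`HOME/pub-hodgecm-own-htheta/stage80/HodgeCM/Model/Binders/Gen12PinsROGT2Ge.lean`, md5 f14cf400686c, 131 lines);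
landed by the p-seat packager p gen 32 (p-g32) in gate run 79 as `HodgeCM/Model/Binders/Gen12PinsROGT2Ge.lean` (verbatim).
-/
/-
Copyright (c) 2026 the pub-hodgecm formalisation cell (harness21).  New file, not vendored.
Origin: seat `prover-pub-hodgecm2-item6-p2-0` (unit pub-hodgecm2-item6-p2, TRANSPOSITION item (vi) extra prover p2 queued behind the own-htheta
lineage; coordinator ruling 2026-08-21T13:01:49Z), 2026-08-21 — own-htheta g2 ROUND-2 assignment pub-hodgecm STATUS l.15865 13:09:09Z «(vi-2) D-HEAD
`_ge` TWINS», BATCH 1 (assigned there to item6-p1, who took the tree-side S2 glue instead — pub-hodgecm2/transposition/item-6/p1/STATUS.md 13:29:30Z;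
taken over by p2 so that the D5–D17 twin chain is complete for one cut; hodge-director/ITEM6-SPLIT.md (vi-2)/(vi-4); x2 `D-HEADS-THREADING.md`
8761fc1d3358; x2 `E-HEADS-FACE-BLUEPRINT.md` v1.1 fc085fc795dd §1 rows `gen12`/`real34`).  Target in PKG: `HodgeCM/Model/Binders/Gen12PinsROGT2Ge.lean` (NEW additive
leaf beside `HodgeCM/Model/Binders/Gen12PinsROGT2.lean`, installed md5 1dba3dae2424; imports `HodgeCM.Model.Binders.Gen12PinsROGT2` + `HodgeCM.Model.Binders.Gen12PinsTotalP2Ge`; nothing of record imports it).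
KERNEL ONLY: theorems, no proof holes, nothing cited, no hypothesis kind of E, no `def`; nothing here is a claim of the manuscripts under adjudication;
HC_CM is NOT proved.

WHAT IT IS — the `_ge` twin(s) of D6 `gen12_R2C_of_GOG` (`Binders/Gen12PinsROGT2.lean`:97) and D7 `gen12_R2CE` (:123; FAMILY form: E's scope triple `finrank ℚ c.K = 6 ∧ IsNormalClosure ℚ c.K L ∧ ([L:ℚ] = 24 ∨ 48)` in the slot type replaced by the single guard `6 ≤ finrank ℚ c.K` — the `IsNormalClosure`/`24∨48` conjuncts are DEAD in D7, x2 D-HEADS row D7):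
statements VERBATIM with the sextic guard `(hK : Module.finrank ℚ c.K = 6)` replaced by `(hK : 6 ≤ Module.finrank ℚ c.K)` (what a rank-four face of a
Galois CM field `F` of degree ≥ 6 supplies at `c.K := F`), proofs = the originals' with D6: the ONE call `gen12_totalAt` ↦ `gen12_totalAt_ge`; D7: `gen12_R2C_of_GOG … hc hK.1` ↦ `gen12_R2C_of_GOG_ge … hc hK`.
E's sextic heads are the instances `hK := h6.ge` (`Model.six_le_of_finrank_eq_six`, `ThetaSpaceInputPinGe.lean`:76).
Generated from the installed original by `work/gen_twins_b1.py` (token edits listed in `work/gen_twins_b1.report`); section variables byte-identical.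
-/
import Summits.HodgeConjecture.HodgeCM.Model.Binders.Gen12PinsROGT2
import Summits.HodgeConjecture.HodgeCM.Model.Binders.Gen12PinsTotalP2Ge

/-! PORT of `HodgeCM/Model/Binders/Gen12PinsROGT2Ge.lean` (HodgeCMPerL run 82) — verbatim mechanical port; provenance in the PORT header line. -/

set_option autoImplicit false

noncomputable section

open MeasureTheory NumberField

namespace HodgeCM.Model

open HodgeCM HodgeCM.Universe HodgeCM.Adelic
open Literature.NumberTheory.Weil1964
open Literature.NumberTheory.Automorphic (piSchwartzBruhat archWeight)
open Literature.NumberTheory.GelbartRogawski1991.UnitaryDualPair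
open Literature.AlgebraicGeometry.HodgeTheory
open Literature.NumberTheory.Automorphic.PicardCM
open Literature.NumberTheory.Transcendental (Arapura2012_Cor_15_4_6)
open HodgeCM.Model.ThetaSpace
open HodgeCM.Model.ArchSideTerm

namespace Gen12PinsP2

variable
  (hGR : ∀ {L : CMField} {ι₁ : L →+* ℂ} (V : HermSpace3 L ι₁) (c : SeesawCtx L),
    (cmSplittingDatum (L : Type) finProdFinEquiv (frameD V) (frameD_real V) (frameD_ne V) (dW c.D) (dW_real c.D)
      (dW_ne c.D)).CompatibleSplitting)
  (hGR₀ : ∀ {L : CMField} {ι₁ : L →+* ℂ} (V : HermSpace3 L ι₁) (c : SeesawCtx L),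
    (cmSplittingDatum (L : Type) (e₁) (frameD V) (frameD_real V) (frameD_ne V) (lineVec (L : Type) (dW c.D 0))
      (fun _ => dW_real c.D 0) (fun _ => dW_ne c.D 0)).CompatibleSplitting)
  (hGR₁ : ∀ {L : CMField} {ι₁ : L →+* ℂ} (V : HermSpace3 L ι₁) (c : SeesawCtx L),
    (cmSplittingDatum (L : Type) (e₁) (frameD V) (frameD_real V) (frameD_ne V) (lineVec (L : Type) (dW c.D 1))
      (fun _ => dW_real c.D 1) (fun _ => dW_ne c.D 1)).CompatibleSplitting)
  (hGR₂ : ∀ {L : CMField} {ι₁ : L →+* ℂ} (V : HermSpace3 L ι₁) (c : SeesawCtx L),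
    (cmSplittingDatum (L : Type) (e₁) (frameD V) (frameD_real V) (frameD_ne V) (lineVec (L : Type) (dW' c.D 0))
      (fun _ => dW'_real c.D 0) (fun _ => dW'_ne c.D 0)).CompatibleSplitting)
  (hGR₃ : ∀ {L : CMField} {ι₁ : L →+* ℂ} (V : HermSpace3 L ι₁) (c : SeesawCtx L),
    (cmSplittingDatum (L : Type) (e₁) (frameD V) (frameD_real V) (frameD_ne V) (lineVec (L : Type) (dW' c.D 1))
      (fun _ => dW'_real c.D 1) (fun _ => dW'_ne c.D 1)).CompatibleSplitting)
  (μ : ∀ {L : CMField}, SeesawCtx L → Fin 4 → NumberField.InfinitePlace (L : Type) → ℤ)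
  (hΔ₁ : ∀ {L : CMField} {ι₁ : L →+* ℂ} (V : HermSpace3 L ι₁) (c : SeesawCtx L), ∀ hc : SInstance.GOG V c,
    slotTypeVec V c (hGR V c) (hGR₀ V c) (hGR₁ V c) (hGR₂ V c) (hGR₃ V c) (SInstance.hG_GOG V c hc) 1 -
      slotTypeVec V c (hGR V c) (hGR₀ V c) (hGR₁ V c) (hGR₂ V c) (hGR₃ V c) (SInstance.hG_GOG V c hc) 0 = μ c 1 - μ c 0)
  (hΔ₂ : ∀ {L : CMField} {ι₁ : L →+* ℂ} (V : HermSpace3 L ι₁) (c : SeesawCtx L), ∀ hc : SInstance.GOG V c,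
    slotTypeVec V c (hGR V c) (hGR₀ V c) (hGR₁ V c) (hGR₂ V c) (hGR₃ V c) (SInstance.hG_GOG V c hc) 2 -
      slotTypeVec V c (hGR V c) (hGR₀ V c) (hGR₁ V c) (hGR₂ V c) (hGR₃ V c) (SInstance.hG_GOG V c hc) 0 = μ c 2 - μ c 0)
  (hΔ₃ : ∀ {L : CMField} {ι₁ : L →+* ℂ} (V : HermSpace3 L ι₁) (c : SeesawCtx L), ∀ hc : SInstance.GOG V c,
    slotTypeVec V c (hGR V c) (hGR₀ V c) (hGR₁ V c) (hGR₂ V c) (hGR₃ V c) (SInstance.hG_GOG V c hc) 3 -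
      slotTypeVec V c (hGR V c) (hGR₀ V c) (hGR₁ V c) (hGR₂ V c) (hGR₃ V c) (SInstance.hG_GOG V c hc) 0 = μ c 3 - μ c 0)

variable (hHD : exists_isReal_hodgeModel) (hI : hodgePQ_independent_of_hodgeModel)
  (h₁ : BallQuotientUniformised)  (h₃ : CMAbelianVarietyRealised)
  (h : Bool) (hA : Arapura2012_Cor_15_4_6)

/- the pins, spelled out: η_S := `@EtaChi.η (@SInstance.χVR @hGR @hGR₀ @hGR₁) (@SInstance.χWR @hGR @hGR₀ @hGR₁ @μ)` (likewise `hη_S`, `hηc_S`),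
   W := `Gen12Pins.Wg @hGR η_S hη_S hηc_S @Gen12Pins.τSyl @Gen12Pins.TSyl @Gen12Pins.hTSyl` (= `HypCensus.Wcm hGR η_S hη_S hηc_S`, rfl — #32),
   S := `SInstance.SROGT'C @hGR @hGR₀ @hGR₁ @hGR₂ @hGR₃ @μ hΔ₁ hΔ₂ hΔ₃`
     (= `SInstance.SGPT' @SInstance.GOG @SInstance.hG_GOG @hGR η_S hη_S hηc_S @νR @hνR @hνcR @ν'R @hν'R @hν'cR @hGR₀..₃ @(SInstance.ART' … @SInstance.hpos_GOG hΔ₁ hΔ₂ hΔ₃)`, rfl). -/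


section Pointwise

variable {L : CMField} {ι₁ : L →+* ℂ} (V : HermSpace3 L ι₁) (c : SeesawCtx L)

/-- `_ge` TWIN of `gen12_R2C_of_GOG` (guard `6 ≤ [c.K:ℚ]` in place of `= 6`; statement otherwise verbatim, proof = the original's with the `_ge` callee). **Row 16 ON THE GUARD at the constructed pin R2 `SROGT'C`** (pointwise; bit `h` free; the R2 twin of #37 `Gen12PinsP.gen12_ROG_of_GOG`):
at a good sextic context with `hg : GOG V c`, E's `Gen12FunBridge V c` for the model at `W := Wg @hGR η_S hη_S hηc_S @τSyl @TSyl @hTSyl`,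
`S := SROGT'C @hGR @hGR₀..₃ @μ hΔ₁ hΔ₂ hΔ₃` is inhabited — NO residual hypothesis (`Gen12PinsTotalP2.gen12_totalAt` at `G := GOG`,
`AG := ART'`; the (N1)₀,₁ weights of `ART'` are those of `AR`, i.e. `archWeight L (μ c k)` literally). -/
theorem gen12_R2C_of_GOG_ge (hg : SInstance.GOG V c)
    (hc : (pinT hHD hI h₁ h₃ h hA
      (Gen12Pins.Wg @hGR (@EtaChi.η (@SInstance.χVR @hGR @hGR₀ @hGR₁) (@SInstance.χWR @hGR @hGR₀ @hGR₁ @μ)) (@EtaChi.hη (@SInstance.χVR @hGR @hGR₀ @hGR₁) (@SInstance.χWR @hGR @hGR₀ @hGR₁ @μ))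
        (@EtaChi.hηc (@SInstance.χVR @hGR @hGR₀ @hGR₁) (@SInstance.χWR @hGR @hGR₀ @hGR₁ @μ)) @Gen12Pins.τSyl @Gen12Pins.TSyl @Gen12Pins.hTSyl)
      (SInstance.SROGT'C @hGR @hGR₀ @hGR₁ @hGR₂ @hGR₃ @μ hΔ₁ hΔ₂ hΔ₃) μ).GoodCtx ι₁ c)
    (hK : 6 ≤ Module.finrank ℚ c.K) :
    Nonempty ((pinT hHD hI h₁ h₃ h hA
      (Gen12Pins.Wg @hGR (@EtaChi.η (@SInstance.χVR @hGR @hGR₀ @hGR₁) (@SInstance.χWR @hGR @hGR₀ @hGR₁ @μ)) (@EtaChi.hη (@SInstance.χVR @hGR @hGR₀ @hGR₁) (@SInstance.χWR @hGR @hGR₀ @hGR₁ @μ))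
        (@EtaChi.hηc (@SInstance.χVR @hGR @hGR₀ @hGR₁) (@SInstance.χWR @hGR @hGR₀ @hGR₁ @μ)) @Gen12Pins.τSyl @Gen12Pins.TSyl @Gen12Pins.hTSyl)
      (SInstance.SROGT'C @hGR @hGR₀ @hGR₁ @hGR₂ @hGR₃ @μ hΔ₁ hΔ₂ hΔ₃) μ).Gen12FunBridge V c) :=
  gen12_totalAt_ge @SInstance.GOG @SInstance.hG_GOG @hGR (@EtaChi.η (@SInstance.χVR @hGR @hGR₀ @hGR₁) (@SInstance.χWR @hGR @hGR₀ @hGR₁ @μ))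
    (@EtaChi.hη (@SInstance.χVR @hGR @hGR₀ @hGR₁) (@SInstance.χWR @hGR @hGR₀ @hGR₁ @μ)) (@EtaChi.hηc (@SInstance.χVR @hGR @hGR₀ @hGR₁) (@SInstance.χWR @hGR @hGR₀ @hGR₁ @μ))
    (@SInstance.νR @hGR₁) (@SInstance.hνR @hGR₁) (@SInstance.hνcR @hGR₁) (@SInstance.ν'R @hGR₃) (@SInstance.hν'R @hGR₃) (@SInstance.hν'cR @hGR₃) @hGR₀ @hGR₁ @hGR₂ @hGR₃
    (@SInstance.ART' @SInstance.GOG @SInstance.hG_GOG @hGR (@SInstance.χVR @hGR @hGR₀ @hGR₁) (@SInstance.νR @hGR₁) (@SInstance.ν'R @hGR₃) @hGR₀ @hGR₁ @hGR₂ @hGR₃ @μ @SInstance.hpos_GOG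
      (fun V c hc => hΔ₁ V c hc) (fun V c hc => hΔ₂ V c hc) (fun V c hc => hΔ₃ V c hc))
    hHD hI h₁ h₃ h hA @μ V c hg hc hK
    (fun k _ => (ArchSideTerm.archLineInputT'_w V c.D _ _ _ _ _ _ _ _ k _).trans (ArchSideTerm.archLineInputOf_w _ k))

end Pointwise

/-- `_ge` TWIN of `gen12_R2CE` (guard `6 ≤ [c.K:ℚ]` in place of `= 6`; statement otherwise verbatim, proof = the original's with the `_ge` callee). **Row 16 (`gen12`) IN E's OWN TEXT at the R2 pins, NO residual hypothesis** (the R2 twin of #39 `Gen12PinsP.gen12_ROGE`): for every good sextic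
canonical context of the model at `W := wmOfInput (HypCensus.Wcm hGR η_S hη_S hηc_S)`, `S := SROGT'C @hGR @hGR₀..₃ @μ hΔ₁ hΔ₂ hΔ₃`, bit `orientBitι L ι₁`,
E's `Gen12FunBridge V c` is inhabited.  Proof: `gen12_R2C_of_GOG` on the guard `⟨hcan, GoodCtx⟩` read off the group's own hypotheses.  glue-1's R2-J children
instantiate `μ := ArchSideTerm.muSharp₂₃ μ`, `hΔ₁ := hΔ₁_GOG_muSharp₂₃ …`, `hΔ₂∕₃ := hΔ₂∕₃_GOG_muSharp₂₃ … (hSV_holds @hGR)` and `h₃ := cmAbelianVarietyRealised_of_eigenbasis hHD hI h₃′`. -/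
theorem gen12_R2CE_ge :
    ∀ {L : CMField} {ι₁ : L →+* ℂ} (V : HermSpace3 L ι₁) (c : SeesawCtx L),
      (thetaModelOf hHD hI h₁ h₃ (orientBitι L ι₁) (embOf hHD hI h₁ h₃) (coverOf hHD hI h₁ h₃ hA)
        (wmOfInput (HypCensus.Wcm hGR (@EtaChi.η (@SInstance.χVR @hGR @hGR₀ @hGR₁) (@SInstance.χWR @hGR @hGR₀ @hGR₁ @μ)) (@EtaChi.hη (@SInstance.χVR @hGR @hGR₀ @hGR₁) (@SInstance.χWR @hGR @hGR₀ @hGR₁ @μ))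
          (@EtaChi.hηc (@SInstance.χVR @hGR @hGR₀ @hGR₁) (@SInstance.χWR @hGR @hGR₀ @hGR₁ @μ))))
        (thetaOf _ (thetaClassInputOf _ (fun V c => thetaSpaceInputOf hHD hI h₁ h₃ (SInstance.SROGT'C @hGR @hGR₀ @hGR₁ @hGR₂ @hGR₃ @μ hΔ₁ hΔ₂ hΔ₃) V c)))
        (d12Of μ) (d34Of μ)).GoodCtx ι₁ c → 6 ≤ Module.finrank ℚ c.K →
      (NumberField.InfinitePlace.mk ι₁).embedding = ι₁ →
      Nonempty ((thetaModelOf hHD hI h₁ h₃ (orientBitι L ι₁) (embOf hHD hI h₁ h₃) (coverOf hHD hI h₁ h₃ hA)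
        (wmOfInput (HypCensus.Wcm hGR (@EtaChi.η (@SInstance.χVR @hGR @hGR₀ @hGR₁) (@SInstance.χWR @hGR @hGR₀ @hGR₁ @μ)) (@EtaChi.hη (@SInstance.χVR @hGR @hGR₀ @hGR₁) (@SInstance.χWR @hGR @hGR₀ @hGR₁ @μ))
          (@EtaChi.hηc (@SInstance.χVR @hGR @hGR₀ @hGR₁) (@SInstance.χWR @hGR @hGR₀ @hGR₁ @μ))))
        (thetaOf _ (thetaClassInputOf _ (fun V c => thetaSpaceInputOf hHD hI h₁ h₃ (SInstance.SROGT'C @hGR @hGR₀ @hGR₁ @hGR₂ @hGR₃ @μ hΔ₁ hΔ₂ hΔ₃) V c)))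
        (d12Of μ) (d34Of μ)).Gen12FunBridge V c) :=
  fun {L} {ι₁} V c hc hK hcan =>
    gen12_R2C_of_GOG_ge @hGR @hGR₀ @hGR₁ @hGR₂ @hGR₃ @μ hΔ₁ hΔ₂ hΔ₃ hHD hI h₁ h₃ (orientBitι L ι₁) hA V c
      ⟨hcan, (AdelicThetaCore.thetaModel_goodCtx_iff _ (orientBitι L ι₁) (d12Of μ) (d34Of μ) ι₁ c).mp hc⟩ hc hK

end Gen12PinsP2

end HodgeCM.Model

end
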